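import Mathlib.MeasureTheory.Integral.IntegralEqImproper
import Mathlib.MeasureTheory.Integral.Prod
import Mathlib.Analysis.Calculus.Deriv.Inv
import Literature.Analysis.FluidPDE.ElgindiStripCalculus
import Literature.Analysis.FluidPDE.ElgindiHkTools
import HarnessLib

/-!
# The linearised fundamental model `𝓛`, `𝓛_Γ` of Elgindi and its weighted-`L²` energy identity

Topic `Literature/Analysis/FluidPDE`. Support file (definitions with their proved API, **no named
facts**) on the proof path of the named fact
`Literature.Analysis.FluidPDE.Elgindi.ElgindiGhoulMasmoudi2021_stabilityCore`
(`ElgindiStabilityDecomposition.lean`): the first step of the printed proof of the stability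
theorem is the coercivity of the linearised operator in the weighted spaces `𝓗ᵏ`
(Elgindi–Ghoul–Masmoudi, Camb. J. Math. 9 (2021) = arXiv:1910.14071, §3, Def. 3.1 and Prop. 3.2,
p. 10 of the held text: "we proceed by induction on `k`. We know that `𝓛_{F_*}^T` is coercive in
`𝓗²` [E_Classical]"), whose base case is §5 of T. M. Elgindi, Ann. of Math. 194 (2021) =
arXiv:1904.04795 (`[Elgindi2021]`, p. 15 of the held text, "Linearization of the Fundamental Model
in Self-Similar Variables"). This file renders the operators of [Elgindi2021] Def. 5.1 (=
[ElgindiGhoulMasmoudi2021] Def. 3.1) and proves the algebraic identity (LW) of Lemma 5.3 and the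
energy identity `(𝓛(f)w, fw)_{L²} = ½|fw|²_{L²}` with which the proof of Prop. 5.5 (the weighted
`L²` coercivity `(𝓛_Γ(f)w, fw) ≥ ¼|fw|²`) begins ("where we used (LW) and the definition of `w` in
the second equality").

## The printed statements ([Elgindi2021] §5, p. 15)

* Definition 5.1: `𝓛_Γ(f) = f + z∂_z f − 2f/(1+z) − (2zΓ(θ)/(c(1+z)²)) L₁₂(f)`,
  `𝓛(f) = f + z∂_z f − 2f/(1+z)`; Definition 5.2: `w = (1+z)²/z²`
  (`Elgindi.radialWeight` of `ElgindiWeightedSpaces.lean`). [ElgindiGhoulMasmoudi2021] Def. 3.1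
  writes the same operators as `𝓛_{F_*}`, `𝓛` in the variable `y` ("`𝓛_{F_*}` is the
  linearization of the fundamental model around `F_*`").
* Lemma 5.3, (LW): `𝓛(g)w = gw + z∂_z(gw)` ("`𝓛(g)w = gw + z∂_z(gw) − (2/(1+z))gw − gz∂_z w = … =
  gw + z∂_z(gw)`", using `z∂_z w = −2(1+z)/z² · … `, i.e. `w' = −2(1+z)/z³`).
* Proof of Proposition 5.5, first two displays: `(𝓛(f)w, fw)_{L²} = ½|fw|²_{L²}` (by (LW) and
  `∫ z∂_z(g²)/2 dz = −½∫ g² dz`).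

## Rendering

Curried functions `f z θ` as in the framework files; `Elgindi.opL f`, `Elgindi.opLΓ α f` are
pointwise expressions in `Elgindi.Dz` (`= z∂_z` through Mathlib's slice `deriv`) and `Elgindi.L12`.
The energy identity is proved for `f` of class `C¹` with compact support inside the open strip
(the class on which [Elgindi2021] proves Lemma 5.4/Prop. 5.5: "We will establish the result for
smooth functions with `f` and `L₁₂(f)` vanishing (at least) quadratically at zero. The general
case will follow by approximation"), as an identity of Bochner integrals over `Elgindi.strip` for
the measure `dz dθ`; the inner `z`-integration by parts is `∫ z h' = −∫ h` for compactly supported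
`h ∈ C¹(ℝ)`, and Fubini is Mathlib's `integral_prod_symm`.

## What is proved

`opL_mul_radialWeight` ((LW), pointwise for `z ≠ 0, −1`), `hasDerivAt_radialWeight`
(`w' = −2(1+z)/z³`), `integral_mul_deriv_eq_neg` (`∫ z h' dz = −∫ h`),
`integral_fst_mul_deriv_slice_eq_neg` (the same inside a double integral),
`contDiff_of_contDiffOn_strip` (a function `Cⁿ` on the strip and supported inside it is `Cⁿ`), and
**`integral_strip_opL_energy`**: `∫∫_strip 𝓛(f) f w² = ½ ∫∫_strip (fw)²`.

## What is NOT here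

Lemma 5.3 (L12L) `L₁₂(𝓛_Γ f) = 𝓛(L₁₂ f)` and the calculus of `L₁₂` (`(L₁₂f)' = −z⁻¹∫K f dθ`),
Lemma 5.4 (the Hardy-type inequality `|L₁₂(f)w|_{L²} ≤ 4|fw|_{L²}`), the bound
`|Γ/c − K|_{L²} ≤ 7/10` and Prop. 5.5 itself — the next files of this proof path.

Mathlib/tree search (`lean search 'opL|linearis|Elgindi.*coerc' --decl`): nothing on these
operators in Mathlib or the tree. Used from Mathlib: `HasDerivAt.div/mul`,
`integral_of_hasDerivAt_of_tendsto`, `integral_prod_symm`, `HasCompactSupport.is_zero_at_infty`,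
`setIntegral_eq_integral_of_forall_compl_eq_zero`.
-/

noncomputable section

open MeasureTheory Set Function Real Filter
open _root_.Topology

namespace Literature.Analysis.FluidPDE

namespace Elgindi

/-! ### Definition 5.1: the operators `𝓛` and `𝓛_Γ` -/

/-- **The operator `𝓛`** of the linearised fundamental model, `𝓛(f) = f + z∂_z f − 2f/(1+z)`
(Elgindi 2021, Definition 5.1; Elgindi–Ghoul–Masmoudi 2021, Definition 3.1, in the variable `y`).
Pointwise on curried functions, `z∂_z = Elgindi.Dz`. [cite: Elgindi2021, §5 Definition 5.1 (p. 15 of arXiv:1904.04795)] -/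
def opL (f : ℝ → ℝ → ℝ) (z θ : ℝ) : ℝ :=
  f z θ + Dz f z θ - 2 * f z θ / (1 + z)

/-- **The linearisation `𝓛_Γ` of the fundamental model around `F_*`**,
`𝓛_Γ(f) = f + z∂_z f − 2f/(1+z) − (2zΓ(θ)/(c(1+z)²)) L₁₂(f)(z)` (Elgindi 2021, Definition 5.1;
written `𝓛_{F_*}` in Elgindi–Ghoul–Masmoudi 2021, Definition 3.1: "`𝓛_{F_*}` is the linearization
of the fundamental model around `F_*`"), with `Γ = Elgindi.angularWeight α`,
`c = Elgindi.profileConst α`, `L₁₂ = Elgindi.L12`. [cite: Elgindi2021, §5 Definition 5.1 (p. 15 of arXiv:1904.04795)]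
[cite: ElgindiGhoulMasmoudi2021, §3 Definition 3.1 (p. 10 of arXiv:1910.14071)] -/
def opLΓ (α : ℝ) (f : ℝ → ℝ → ℝ) (z θ : ℝ) : ℝ :=
  opL f z θ - 2 * z * angularWeight α θ / (profileConst α * (1 + z) ^ 2) * L12 f z

/-- Unfolding `𝓛`. [folklore] -/
theorem opL_apply (f : ℝ → ℝ → ℝ) (z θ : ℝ) :
    opL f z θ = f z θ + Dz f z θ - 2 * f z θ / (1 + z) := rfl

/-- Unfolding `𝓛_Γ`: `𝓛_Γ(f) = 𝓛(f) − (2zΓ/(c(1+z)²)) L₁₂(f)` (Elgindi 2021, proof of Prop. 5.5: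
"Observe that `𝓛_Γ(f) = 𝓛(f) − (2Γz/(c(1+z)²))L₁₂(f)`"). [cite: Elgindi2021, §5, proof of Proposition 5.5 (p. 15)] -/
theorem opLΓ_apply (α : ℝ) (f : ℝ → ℝ → ℝ) (z θ : ℝ) :
    opLΓ α f z θ =
      opL f z θ - 2 * z * angularWeight α θ / (profileConst α * (1 + z) ^ 2) * L12 f z := rfl

/-- `𝓛(0) = 0`. [folklore] -/
@[simp] theorem opL_zero : opL 0 = 0 := by
  funext z θ
  simp [opL]

/-! ### Lemma 5.3 (LW): `𝓛(g)w = gw + z∂_z(gw)` -/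

/-- **`w' = −2(1+z)/z³`** for the radial weight `w = (1+z)²/z²`, `z ≠ 0` (the computation
"`gz∂_z w = −gz(2/z² + 2/z³)`" inside the proof of Lemma 5.3). [cite: Elgindi2021, §5 Lemma 5.3, proof (p. 15)] -/
theorem hasDerivAt_radialWeight {z : ℝ} (hz : z ≠ 0) :
    HasDerivAt radialWeight (-2 * (1 + z) / z ^ 3) z := by
  have hu : HasDerivAt (fun z : ℝ => (1 + z) ^ 2) (2 * (1 + z)) z := by
    simpa using ((hasDerivAt_id' z).const_add 1).fun_pow 2
  have hv : HasDerivAt (fun z : ℝ => z ^ 2) (2 * z) z := by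
    simpa using (hasDerivAt_id' z).fun_pow 2
  have h := hu.div hv (pow_ne_zero 2 hz)
  refine (h.congr_of_eventuallyEq (Eventually.of_forall fun y => rfl)).congr_deriv ?_
  field_simp
  ring

/-- **Lemma 5.3, (LW)**: `𝓛(g)w = gw + z∂_z(gw)` pointwise at every `z ≠ 0, −1` where the slice
`z' ↦ g(z', θ)` is differentiable (Elgindi 2021, Lemma 5.3: "`𝓛(g)w = gw + z∂_z(gw) − (2/(1+z))gw −
gz∂_z w = gw + z∂_z(gw) − (2/(1+z))gw + gz(2/z² + 2/z³) = gw + z∂_z(gw)`"). [cite: Elgindi2021, §5 Lemma 5.3 (LW) (p. 15 of arXiv:1904.04795)] -/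
theorem opL_mul_radialWeight {g : ℝ → ℝ → ℝ} {z θ g' : ℝ} (hz : z ≠ 0) (hz1 : 1 + z ≠ 0)
    (hg : HasDerivAt (fun z' => g z' θ) g' z) :
    opL g z θ * radialWeight z =
      g z θ * radialWeight z + z * deriv (fun z' => g z' θ * radialWeight z') z := by
  rw [(hg.fun_mul (hasDerivAt_radialWeight hz)).deriv, opL_apply, Dz_apply, hg.deriv]
  unfold radialWeight
  field_simp
  ring

/-! ### Functions supported inside the open strip -/

/-- A function which is `Cⁿ` on the open strip and whose topological support lies inside the strip
is `Cⁿ` on the whole plane (it vanishes near every point off the strip). [folklore] -/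
theorem contDiff_of_contDiffOn_strip {F : ℝ × ℝ → ℝ} {n : WithTop ℕ∞} (hF : ContDiffOn ℝ n F strip)
    (hsub : tsupport F ⊆ strip) : ContDiff ℝ n F := by
  refine contDiff_iff_contDiffAt.2 fun p => ?_
  by_cases hp : p ∈ strip
  · exact hF.contDiffAt (strip_mem_nhds hp)
  · have h0 : F =ᶠ[𝓝 p] 0 := notMem_tsupport_iff_eventuallyEq.1 fun h => hp (hsub h)
    exact (contDiffAt_const (c := (0 : ℝ))).congr_of_eventuallyEq h0

/-- Off its topological support a function has vanishing slice derivative in `z`. [folklore] -/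
theorem deriv_slice_fst_eq_zero_of_notMem_tsupport {F : ℝ × ℝ → ℝ} {p : ℝ × ℝ}
    (hp : p ∉ tsupport F) : deriv (fun z => F (z, p.2)) p.1 = 0 := by
  have h0 : F =ᶠ[𝓝 p] 0 := notMem_tsupport_iff_eventuallyEq.1 hp
  have hc : Continuous fun z : ℝ => (z, p.2) := by fun_prop
  have h1 : (fun z => F (z, p.2)) =ᶠ[𝓝 p.1] fun _ => 0 := by
    have := hc.continuousAt.tendsto.eventually (show ∀ᶠ q in 𝓝 (p.1, p.2), F q = 0 from h0)
    exact this
  rw [h1.deriv_eq]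
  exact deriv_const p.1 0

/-! ### Integration by parts in `z`: `∫ z h' = −∫ h` -/

/-- **`∫ z h'(z) dz = −∫ h(z) dz`** for `h ∈ C¹(ℝ)` with compact support (the one-dimensional
integration by parts behind "`∫ z∂_z(g²) = −∫ g²`"; `(zh)' = h + zh'` integrates to `0`). [folklore] -/
theorem integral_mul_deriv_eq_neg {h : ℝ → ℝ} (hh : ContDiff ℝ 1 h) (hsupp : HasCompactSupport h) :
    ∫ z, z * deriv h z = -∫ z, h z := by
  have hhc : Continuous h := hh.continuous
  have hd : ∀ z, HasDerivAt h (deriv h z) z := fun z =>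
    ((hh.differentiable (by norm_num)) z).hasDerivAt
  have hh'c : Continuous (deriv h) := hh.continuous_deriv_one
  have hh's : HasCompactSupport (deriv h) := hsupp.deriv
  -- `F = z h`, `F' = h + z h'`
  have hF : ∀ z, HasDerivAt (fun z => z * h z) (h z + z * deriv h z) z := fun z => by
    simpa using (hasDerivAt_id' z).fun_mul (hd z)
  have hi1 : Integrable h := hhc.integrable_of_hasCompactSupport hsupp
  have hi2 : Integrable fun z => z * deriv h z :=
    (continuous_id.mul hh'c).integrable_of_hasCompactSupport hh's.mul_left
  have hFs : HasCompactSupport fun z => z * h z := hsupp.mul_left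
  have hF0 : Tendsto (fun z => z * h z) (cocompact ℝ) (𝓝 0) := hFs.is_zero_at_infty
  have htop : Tendsto (fun z => z * h z) atTop (𝓝 0) := hF0.mono_left atTop_le_cocompact
  have hbot : Tendsto (fun z => z * h z) atBot (𝓝 0) := hF0.mono_left atBot_le_cocompact
  have key := integral_of_hasDerivAt_of_tendsto hF (hi1.add hi2) hbot htop
  rw [integral_add hi1 hi2, sub_zero] at key
  linarith

/-- The partial derivative `∂_z G = DG(·)(1,0)` of a compactly supported `C¹` function, times `z`,
is integrable on the plane (continuous with compact support). [folklore] -/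
theorem integrable_fst_mul_deriv_slice {G : ℝ × ℝ → ℝ} (hG : ContDiff ℝ 1 G)
    (hsupp : HasCompactSupport G) :
    Integrable fun p : ℝ × ℝ => p.1 * deriv (fun z => G (z, p.2)) p.1 := by
  have hder : ∀ p : ℝ × ℝ, deriv (fun z => G (z, p.2)) p.1 = fderiv ℝ G p (1, 0) := fun p =>
    (hasDerivAt_slice_fst ((hG.differentiable (by norm_num)) p)).deriv
  have hDc : Continuous fun p : ℝ × ℝ => fderiv ℝ G p (1, 0) :=
    (hG.continuous_fderiv one_ne_zero).clm_apply continuous_const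
  have hDs : HasCompactSupport fun p : ℝ × ℝ => fderiv ℝ G p (1, 0) :=
    hsupp.fderiv (𝕜 := ℝ) |>.comp_left (g := fun L : ℝ × ℝ →L[ℝ] ℝ => L (1, 0)) (by simp)
  have hc : Continuous fun p : ℝ × ℝ => p.1 * fderiv ℝ G p (1, 0) := continuous_fst.mul hDc
  exact (hc.integrable_of_hasCompactSupport hDs.mul_left).congr
    (Eventually.of_forall fun p => by simp only [hder])

/-- **The same inside a double integral**: for `G ∈ C¹(ℝ²)` with compact support,
`∫∫ z ∂_z G(z, θ) dz dθ = −∫∫ G` (Fubini, then `integral_mul_deriv_eq_neg` on each `θ`-slice). [folklore] -/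
theorem integral_fst_mul_deriv_slice_eq_neg {G : ℝ × ℝ → ℝ} (hG : ContDiff ℝ 1 G)
    (hsupp : HasCompactSupport G) :
    ∫ p : ℝ × ℝ, p.1 * deriv (fun z => G (z, p.2)) p.1 = -∫ p : ℝ × ℝ, G p := by
  have hI := integrable_fst_mul_deriv_slice hG hsupp
  have hIG : Integrable G := hG.continuous.integrable_of_hasCompactSupport hsupp
  -- Fubini with the `z`-integral inside
  rw [Measure.volume_eq_prod] at hI hIG ⊢
  rw [integral_prod_symm _ hI, integral_prod_symm _ hIG, ← integral_neg]
  refine integral_congr_ae (Eventually.of_forall fun θ => ?_)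
  -- each slice `z ↦ G(z, θ)` is `C¹` with compact support
  have hsl : ContDiff ℝ 1 fun z => G (z, θ) := hG.comp (contDiff_prodMk_left θ)
  have hsls : HasCompactSupport fun z => G (z, θ) :=
    HasCompactSupport.of_support_subset_isCompact (hsupp.image continuous_fst) fun z hz =>
      ⟨(z, θ), subset_tsupport G hz, rfl⟩
  simpa using integral_mul_deriv_eq_neg hsl hsls

/-! ### The energy identity `(𝓛(f)w, fw)_{L²} = ½|fw|²_{L²}` -/

/-- **`(𝓛(f)w, fw)_{L²(dz dθ)} = ½|fw|²_{L²(dz dθ)}`** for `f ∈ C¹` with compact support inside the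
open quarter strip (Elgindi 2021, proof of Proposition 5.5, the passage from the first to the
second display: "`(𝓛_Γ(f)w, fw) = (𝓛(f)w, fw) − … = ½|fw|² − …` where we used (LW) and the
definition of `w` in the second equality"): by (LW), `𝓛(f)w · fw = (fw)² + ½ z∂_z((fw)²)`, and
`∫∫ z∂_z((fw)²) dz dθ = −∫∫ (fw)²`. [cite: Elgindi2021, §5, proof of Proposition 5.5 (p. 15 of arXiv:1904.04795)] -/
theorem integral_strip_opL_energy {f : ℝ → ℝ → ℝ} (hf : ContDiff ℝ 1 (uncurry f))
    (hsupp : HasCompactSupport (uncurry f)) (hsub : tsupport (uncurry f) ⊆ strip) :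
    ∫ p in strip, opL f p.1 p.2 * f p.1 p.2 * radialWeight p.1 ^ 2 =
      (1 / 2) * ∫ p in strip, (f p.1 p.2 * radialWeight p.1) ^ 2 := by
  -- `g = fw` and `G = g²` as functions on `ℝ × ℝ`
  set g : ℝ × ℝ → ℝ := fun p => f p.1 p.2 * radialWeight p.1 with hg
  set G : ℝ × ℝ → ℝ := fun p => g p ^ 2 with hGdef
  have hw : ContDiffOn ℝ 1 (fun p : ℝ × ℝ => radialWeight p.1) strip := by
    unfold radialWeight
    refine ContDiffOn.div (by fun_prop) (by fun_prop) fun p hp => ?_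
    exact pow_ne_zero 2 (ne_of_gt hp.1)
  have hgon : ContDiffOn ℝ 1 g strip := (hf.contDiffOn.congr fun p _ => rfl).mul hw
  have hg_sub : tsupport g ⊆ tsupport (uncurry f) :=
    tsupport_mul_subset_left (f := uncurry f) (g := fun p : ℝ × ℝ => radialWeight p.1)
  have hgC : ContDiff ℝ 1 g := contDiff_of_contDiffOn_strip hgon (hg_sub.trans hsub)
  have hgs : HasCompactSupport g := hsupp.mul_right
  have hGC : ContDiff ℝ 1 G := hgC.pow 2
  have hGs : HasCompactSupport G := by
    have : G = g * g := by funext p; simp [hGdef, sq]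
    rw [this]; exact hgs.mul_right
  have hG_sub : tsupport G ⊆ strip := by
    have : G = g * g := by funext p; simp [hGdef, sq]
    rw [this]
    exact (tsupport_mul_subset_left (f := g) (g := g)).trans (hg_sub.trans hsub)
  -- pointwise on the strip: `𝓛(f) f w² = G + ½ z ∂_z G`
  have hpt : ∀ p ∈ strip, opL f p.1 p.2 * f p.1 p.2 * radialWeight p.1 ^ 2 =
      G p + (1 / 2) * (p.1 * deriv (fun z => G (z, p.2)) p.1) := by
    intro p hp
    have hz : p.1 ≠ 0 := ne_of_gt hp.1
    have hz1 : 1 + p.1 ≠ 0 := by have : (0 : ℝ) < p.1 := hp.1; positivity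
    have hfd : DifferentiableAt ℝ (uncurry f) p := (hf.differentiable (by norm_num)) p
    have hslice : HasDerivAt (fun z' => f z' p.2) (fderiv ℝ (uncurry f) p (1, 0)) p.1 :=
      hasDerivAt_slice_fst hfd
    have hLW := opL_mul_radialWeight hz hz1 hslice
    -- the slice of `g` and of `G = g²`
    have hgsl : HasDerivAt (fun z' => f z' p.2 * radialWeight z')
        (deriv (fun z' => f z' p.2 * radialWeight z') p.1) p.1 :=
      (hslice.fun_mul (hasDerivAt_radialWeight hz)).differentiableAt.hasDerivAt
    have hGsl : deriv (fun z => G (z, p.2)) p.1 =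
        2 * g p * deriv (fun z' => f z' p.2 * radialWeight z') p.1 := by
      have := (hgsl.fun_pow 2).deriv
      simp only [hGdef, hg] at this ⊢
      rw [this]
      ring
    rw [hGsl]
    simp only [hGdef, hg]
    have e : opL f p.1 p.2 * f p.1 p.2 * radialWeight p.1 ^ 2 =
        (opL f p.1 p.2 * radialWeight p.1) * (f p.1 p.2 * radialWeight p.1) := by ring
    rw [e, hLW]
    ring
  -- integrate: the derivative term integrates to `−∫ G`
  have hIG : Integrable G := hGC.continuous.integrable_of_hasCompactSupport hGs
  have hD := integral_fst_mul_deriv_slice_eq_neg hGC hGs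
  have hID := integrable_fst_mul_deriv_slice hGC hGs
  -- replace the set integrals by integrals over the plane (all integrands vanish off the strip)
  have hzero : ∀ p, p ∉ strip → G p = 0 := fun p hp =>
    image_eq_zero_of_notMem_tsupport fun h => hp (hG_sub h)
  have hzeroD : ∀ p : ℝ × ℝ, p ∉ strip → p.1 * deriv (fun z => G (z, p.2)) p.1 = 0 := by
    intro p hp
    rw [deriv_slice_fst_eq_zero_of_notMem_tsupport fun h => hp (hG_sub h), mul_zero]
  calc ∫ p in strip, opL f p.1 p.2 * f p.1 p.2 * radialWeight p.1 ^ 2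
      = ∫ p in strip, (G p + (1 / 2) * (p.1 * deriv (fun z => G (z, p.2)) p.1)) :=
        setIntegral_congr_fun measurableSet_strip hpt
    _ = ∫ p, (G p + (1 / 2) * (p.1 * deriv (fun z => G (z, p.2)) p.1)) := by
        refine setIntegral_eq_integral_of_forall_compl_eq_zero fun p hp => ?_
        rw [hzero p hp, hzeroD p hp]; ring
    _ = (∫ p, G p) + (1 / 2) * ∫ p : ℝ × ℝ, p.1 * deriv (fun z => G (z, p.2)) p.1 := by
        rw [integral_add hIG (hID.const_mul _), integral_const_mul]
    _ = (1 / 2) * ∫ p, G p := by rw [hD]; ring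
    _ = (1 / 2) * ∫ p in strip, (f p.1 p.2 * radialWeight p.1) ^ 2 := by
        rw [setIntegral_eq_integral_of_forall_compl_eq_zero fun p hp => hzero p hp]

end Elgindi

end Literature.Analysis.FluidPDE
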